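import Literature.Computability.Cryptography.RegevCVPOracleFn
import Literature.Computability.QuantumComplexity.GaussianCells
import Literature.Computability.QuantumComplexity.RevUncomputeUniform
import Literature.Computability.Complexity.CodeFPStringKit
import Literature.Computability.Complexity.CodeFPStrings
import Literature.Computability.Complexity.CodeFPLists
import Literature.Computability.Complexity.EasyWitnessSearch
import Literature.Computability.Complexity.StackWords
import HarnessLib

/-!
# Regev 2009, Lemma 3.14 in machine form: the register formats of the sampler (tables, readers, round trips)

Topic `Computability/Cryptography` (family `pqc`), grouping namespace `Regev2009.SamplerFormats`; sequel of
`RegevCVPOracleFn.lean` (the query/answer FORMATS of the `CVP` subroutine of Regev's iterative step: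
fixed-width numerals `bitsMSB`, most significant bit first, the residue table `table ℓ s`, the
offset-binary table `tableZ ℓ c`) and `QuantumComplexity/GaussianCells.lean` (the point register: per
coordinate `ℓ` bits, most significant first, standing for the integer `cellPt y = binVal y − 2^{ℓ−1}`). The
classical stage of the sampler (Regev 2009, proof of Lemma 3.14) reads and writes registers in these
formats by polynomial-time string functions; this file supplies the string-level toolkit:

* list versions `bitsMSBL`, `tableL`, `tableZL` of the formats (`bitsMSBL_eq`, `tableL_ofFn`,
  `tableZL_ofFn`), block access `drop_take_tableL`, lengths;
* the READERS `readN ℓ n` / `readZ ℓ n` (`n` blocks of `ℓ` bits back to naturals / offset integers) and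
  the round trips **`readN_tableL`**, **`readZ_tableZL`** (reading a table gives its data back) and
  **`tableL_readN`**, **`tableZL_readZ`** (re-tabulating what was read off a well-sized word gives the word
  back VERBATIM — the erasure of a register by XOR is exact);
* the point register as a table: `pointsWord Y` (the flat content of the `n` coordinate blocks),
  `binVal_eq_bitsToNat_reverse`, `bitsMSBL_binVal`, **`pointsWord_eq_tableL`**, **`readZ_pointsWord`**
  (`= (cellPt (Y i))ᵢ`, the grid vector `x̃`), `tableZL_cellPt`;
* `CodeFP` facts: `codeFP_bitsMSBL`, `codeFP_tableL`, `codeFP_tableZL`, `codeFP_readN`, `codeFP_readZ`.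

Everything is proved; definitions have bodies; no named fact is introduced.

## References

* O. Regev, *On lattices, learning with errors, random linear codes, and cryptography*, J. ACM 56
  (2009), art. 34; author's version arXiv:2401.03703: Lemma 3.14 (proof: "a state on n log R qubits";
  "uncompute the first register") [Regev2009].
* D. E. Knuth, *The Art of Computer Programming*, Vol. 2, 3rd ed., 1998, §4.1 (positional number systems,
  offset binary) [KnuthTAOCP2].
* S. Arora, B. Barak, *Computational Complexity: A Modern Approach*, CUP 2009, §1.3 [AroraBarak2009].
-/

noncomputable section

namespace Literature.Computability.Cryptography

namespace Regev2009

namespace SamplerFormats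

open Literature.Computability.Complexity Literature.Computability.Complexity.CodeFP CVPOracle
  Literature.Computability.QuantumComplexity Literature.Computability.QuantumComplexity.GaussianCells
open _root_.Computability

/-- Integer vectors: raw lists of canonical integer codes. -/
local notation "ivecE" => rawE intE

/-! ### Fixed-width numerals and tables, as list programs -/

/-- The `ℓ`-bit numeral of `v`, most significant bit first: the reversed row word. [cite: KnuthTAOCP2, §4.1] -/
def bitsMSBL (ℓ v : ℕ) : List Bool := (EasyWitness.row ℓ v).reverse

/-- `bitsMSBL = bitsMSB`. [folklore] -/
theorem bitsMSBL_eq (ℓ v : ℕ) : bitsMSBL ℓ v = bitsMSB ℓ v := by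
  unfold bitsMSBL bitsMSB EasyWitness.row
  apply List.ext_getElem (by simp)
  intro i h₁ h₂
  rw [List.getElem_reverse, List.getElem_ofFn, List.getElem_ofFn]
  simp only [List.length_ofFn]

/-- Length of a numeral. [folklore] -/
@[simp] theorem length_bitsMSBL (ℓ v : ℕ) : (bitsMSBL ℓ v).length = ℓ := by simp [bitsMSBL]

/-- Bit `t` of a numeral is bit `ℓ − 1 − t` of the number. [cite: KnuthTAOCP2, §4.1] -/
theorem getElem_bitsMSBL (ℓ v : ℕ) {t : ℕ} (ht : t < (bitsMSBL ℓ v).length) : (bitsMSBL ℓ v)[t] = v.testBit (ℓ - 1 - t) := by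
  unfold bitsMSBL EasyWitness.row
  rw [List.getElem_reverse, List.getElem_ofFn]
  simp only [List.length_ofFn]

/-- The table of a list of naturals. [folklore] -/
def tableL (ℓ : ℕ) (s : List ℕ) : List Bool := (s.map (bitsMSBL ℓ)).flatten

/-- The offset map `z ↦ z + 2^{ℓ−1}` (as a natural). [cite: KnuthTAOCP2, §4.1 (offset binary)] -/
def offs (ℓ : ℕ) (z : ℤ) : ℕ := (z + 2 ^ (ℓ - 1)).toNat

/-- The offset-binary table of a list of integers. [folklore] -/
def tableZL (ℓ : ℕ) (c : List ℤ) : List Bool := tableL ℓ (c.map (offs ℓ))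

/-- `tableL ℓ (ofFn s) = table ℓ s`. [folklore] -/
theorem tableL_ofFn {n : ℕ} (ℓ : ℕ) (s : Fin n → ℕ) : tableL ℓ (List.ofFn s) = CVPOracle.table ℓ s := by
  unfold tableL CVPOracle.table
  rw [List.map_ofFn]
  exact congrArg List.flatten (List.ofFn_inj.2 (funext fun j => bitsMSBL_eq ℓ (s j)))

/-- `tableZL ℓ (ofFn c) = tableZ ℓ c`. [folklore] -/
theorem tableZL_ofFn {n : ℕ} (ℓ : ℕ) (c : Fin n → ℤ) : tableZL ℓ (List.ofFn c) = tableZ ℓ c := by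
  unfold tableZL tableZ tableL offs
  rw [List.map_ofFn, List.map_ofFn]
  exact congrArg List.flatten (List.ofFn_inj.2 (funext fun j => bitsMSBL_eq ℓ _))

/-- Length of a table. [folklore] -/
theorem length_tableL (ℓ : ℕ) (s : List ℕ) : (tableL ℓ s).length = s.length * ℓ := by
  unfold tableL
  induction s with
  | nil => simp
  | cons a s ih => simp [List.flatten_cons, ih, Nat.succ_mul, Nat.add_comm]

/-- Length of an offset-binary table. [folklore] -/
theorem length_tableZL (ℓ : ℕ) (c : List ℤ) : (tableZL ℓ c).length = c.length * ℓ := by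
  unfold tableZL; rw [length_tableL, List.length_map]

/-- Block `i` of a table. [folklore] -/
theorem drop_take_tableL (ℓ : ℕ) (s : List ℕ) {i : ℕ} (hi : i < s.length) :
    ((tableL ℓ s).drop (i * ℓ)).take ℓ = bitsMSBL ℓ (s[i]) := by
  induction s generalizing i with
  | nil => simp at hi
  | cons a s ih =>
    cases i with
    | zero =>
      unfold tableL
      rw [List.map_cons, List.flatten_cons, Nat.zero_mul, List.drop_zero, List.take_left' (length_bitsMSBL ℓ a)]
      rfl
    | succ i =>
      have hi' : i < s.length := by simpa using hi
      have h := ih hi'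
      unfold tableL at h ⊢
      rw [List.map_cons, List.flatten_cons, Nat.succ_mul, Nat.add_comm, ← List.drop_drop, List.drop_left' (length_bitsMSBL ℓ a)]
      exact h

/-- Dropping all blocks before `i`. [folklore] -/
theorem drop_tableL (ℓ : ℕ) (s : List ℕ) (i : ℕ) : (tableL ℓ s).drop (i * ℓ) = tableL ℓ (s.drop i) := by
  induction s generalizing i with
  | nil => simp [tableL]
  | cons a s ih =>
    cases i with
    | zero => simp
    | succ i =>
      unfold tableL at ih ⊢
      rw [List.map_cons, List.flatten_cons, Nat.succ_mul, Nat.add_comm, ← List.drop_drop, List.drop_left' (length_bitsMSBL ℓ a),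
        List.drop_succ_cons]
      exact ih i

/-- Taking the first `i` blocks. [folklore] -/
theorem take_tableL (ℓ : ℕ) (s : List ℕ) (i : ℕ) : (tableL ℓ s).take (i * ℓ) = tableL ℓ (s.take i) := by
  induction s generalizing i with
  | nil => simp [tableL]
  | cons a s ih =>
    cases i with
    | zero => simp [tableL]
    | succ i =>
      unfold tableL at ih ⊢
      rw [List.map_cons, List.flatten_cons, Nat.succ_mul, Nat.add_comm, List.take_append, List.take_of_length_le (by simp),
        length_bitsMSBL, Nat.add_sub_cancel_left, ih i, List.take_succ_cons, List.map_cons, List.flatten_cons]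

/-! ### Readers and round trips -/

/-- **The reader of naturals**: `n` blocks of `ℓ` bits, most significant first. [cite: KnuthTAOCP2, §4.1] -/
def readN (ℓ n : ℕ) (bits : List Bool) : List ℕ := (List.range n).map fun i => bitsToNat ((bits.drop (i * ℓ)).take ℓ).reverse

/-- **The reader of offset integers**: `value − 2^{ℓ−1}` per block. [cite: KnuthTAOCP2, §4.1 (offset binary)] -/
def readZ (ℓ n : ℕ) (bits : List Bool) : List ℤ := (readN ℓ n bits).map fun v : ℕ => (v : ℤ) - 2 ^ (ℓ - 1)

/-- Length of a read list. [folklore] -/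
@[simp] theorem length_readN (ℓ n : ℕ) (bits : List Bool) : (readN ℓ n bits).length = n := by simp [readN]

/-- Length of a read list. [folklore] -/
@[simp] theorem length_readZ (ℓ n : ℕ) (bits : List Bool) : (readZ ℓ n bits).length = n := by simp [readZ]

/-- **The value of a numeral**: `bitsToNat (reverse (bitsMSBL ℓ v)) = v` for `v < 2^ℓ`. [cite: KnuthTAOCP2, §4.1] -/
theorem bitsToNat_reverse_bitsMSBL {ℓ v : ℕ} (hv : v < 2 ^ ℓ) : bitsToNat (bitsMSBL ℓ v).reverse = v := by
  unfold bitsMSBL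
  rw [List.reverse_reverse]
  apply Nat.eq_of_testBit_eq
  intro i
  rw [testBit_bitsToNat_eq_getD, EasyWitness.row, List.getD_eq_getElem?_getD, List.getElem?_ofFn]
  by_cases hi : i < ℓ
  · simp [hi]
  · simp only [hi, dite_false, Option.getD_none]
    rw [Nat.testBit_lt_two_pow (lt_of_lt_of_le hv (Nat.pow_le_pow_right two_pos (not_lt.1 hi)))]

/-- **A word of length `ℓ` is the numeral of its value.** [cite: KnuthTAOCP2, §4.1] -/
theorem bitsMSBL_bitsToNat_reverse {ℓ : ℕ} {w : List Bool} (hw : w.length = ℓ) : bitsMSBL ℓ (bitsToNat w.reverse) = w := by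
  apply List.ext_getElem (by simp [hw])
  intro t h₁ h₂
  rw [getElem_bitsMSBL, testBit_bitsToNat_eq_getD, List.getD_eq_getElem?_getD, List.getElem?_reverse (by rw [hw]; omega),
    List.getElem?_eq_getElem (by rw [hw]; omega), Option.getD_some]
  congr 1
  rw [hw]; omega

/-- **Reading a table gives its data back** (entries `< 2^ℓ`). [cite: KnuthTAOCP2, §4.1] -/
theorem readN_tableL {ℓ : ℕ} {s : List ℕ} (hs : ∀ v ∈ s, v < 2 ^ ℓ) : readN ℓ s.length (tableL ℓ s) = s := by
  unfold readN
  apply List.ext_getElem (by simp)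
  intro i h₁ h₂
  rw [List.getElem_map, List.getElem_range, drop_take_tableL ℓ s h₂, bitsToNat_reverse_bitsMSBL (hs _ (List.getElem_mem h₂))]

/-- The offset map is inverted by the reader's shift on `[−2^{ℓ−1}, 2^{ℓ−1})`. [folklore] -/
theorem offs_sub {ℓ : ℕ} {z : ℤ} (hz : -2 ^ (ℓ - 1) ≤ z) : (offs ℓ z : ℤ) - 2 ^ (ℓ - 1) = z := by
  unfold offs; rw [Int.toNat_of_nonneg (by linarith)]; ring

/-- Offsets of in-range integers fit in `ℓ` bits. [folklore] -/
theorem offs_lt {ℓ : ℕ} (hℓ : 1 ≤ ℓ) {z : ℤ} (hz : -2 ^ (ℓ - 1) ≤ z) (hz' : z < 2 ^ (ℓ - 1)) : offs ℓ z < 2 ^ ℓ := by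
  have h2 : (2 : ℤ) ^ ℓ = 2 * 2 ^ (ℓ - 1) := by
    rw [← pow_succ']; congr 1; omega
  have : ((offs ℓ z : ℕ) : ℤ) < 2 ^ ℓ := by
    unfold offs; rw [Int.toNat_of_nonneg (by linarith), h2]; linarith
  exact_mod_cast this

/-- **Reading an offset-binary table gives its data back** (entries in `[−2^{ℓ−1}, 2^{ℓ−1})`). [cite: KnuthTAOCP2, §4.1] -/
theorem readZ_tableZL {ℓ : ℕ} (hℓ : 1 ≤ ℓ) {c : List ℤ} (hc : ∀ z ∈ c, -2 ^ (ℓ - 1) ≤ z ∧ z < 2 ^ (ℓ - 1)) :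
    readZ ℓ c.length (tableZL ℓ c) = c := by
  unfold readZ tableZL
  have hlen : c.length = (c.map (offs ℓ)).length := (List.length_map _).symm
  rw [hlen, readN_tableL (fun v hv => by
    obtain ⟨z, hz, rfl⟩ := List.mem_map.1 hv
    exact offs_lt hℓ (hc z hz).1 (hc z hz).2), List.map_map]
  conv_rhs => rw [← List.map_id c]
  refine List.map_congr_left fun z hz => ?_
  rw [Function.comp_apply, id, offs_sub (hc z hz).1]

/-- Re-tabulating the offsets of what was read. [folklore] -/
theorem map_offs_readZ (ℓ n : ℕ) (bits : List Bool) : (readZ ℓ n bits).map (offs ℓ) = readN ℓ n bits := by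
  unfold readZ
  rw [List.map_map]
  conv_rhs => rw [← List.map_id (readN ℓ n bits)]
  refine List.map_congr_left fun v _ => ?_
  rw [Function.comp_apply, id, offs]
  simp

/-- A word of `n` blocks of `ℓ` bits is the concatenation of its blocks. [folklore] -/
theorem flatten_blocks (ℓ : ℕ) : ∀ (n : ℕ) (bits : List Bool), bits.length = n * ℓ →
    ((List.range n).map fun i => (bits.drop (i * ℓ)).take ℓ).flatten = bits
  | 0, bits, h => by rw [Nat.zero_mul, List.length_eq_zero_iff] at h; simp [h]
  | n + 1, bits, h => by
    rw [List.range_succ_eq_map, List.map_cons, List.flatten_cons, Nat.zero_mul, List.drop_zero, List.map_map]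
    have hdrop : (bits.drop ℓ).length = n * ℓ := by rw [List.length_drop, h, Nat.succ_mul]; omega
    have ih := flatten_blocks ℓ n (bits.drop ℓ) hdrop
    have hfun : ((fun i => (bits.drop (i * ℓ)).take ℓ) ∘ Nat.succ) = fun i => ((bits.drop ℓ).drop (i * ℓ)).take ℓ := by
      funext i
      rw [Function.comp_apply, List.drop_drop, Nat.succ_mul, Nat.add_comm]
    rw [hfun, ih, List.take_append_drop]

/-- **Re-tabulating what was read off a well-sized word gives the word back verbatim.** [cite: KnuthTAOCP2, §4.1] -/
theorem tableL_readN {ℓ n : ℕ} {bits : List Bool} (h : bits.length = n * ℓ) : tableL ℓ (readN ℓ n bits) = bits := by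
  unfold tableL readN
  rw [List.map_map]
  have hcongr : ((List.range n).map (bitsMSBL ℓ ∘ fun i => bitsToNat ((bits.drop (i * ℓ)).take ℓ).reverse)) =
      (List.range n).map fun i => (bits.drop (i * ℓ)).take ℓ := by
    refine List.map_congr_left fun i hi => ?_
    rw [List.mem_range] at hi
    rw [Function.comp_apply]
    refine bitsMSBL_bitsToNat_reverse ?_
    rw [List.length_take, List.length_drop, h]
    exact min_eq_left (Nat.le_sub_of_add_le (by rw [Nat.add_comm, ← Nat.succ_mul]; exact Nat.mul_le_mul_right ℓ (Nat.succ_le_of_lt hi)))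
  rw [hcongr, flatten_blocks ℓ n bits h]

/-- The same for offset-binary tables. [cite: KnuthTAOCP2, §4.1] -/
theorem tableZL_readZ {ℓ n : ℕ} {bits : List Bool} (h : bits.length = n * ℓ) : tableZL ℓ (readZ ℓ n bits) = bits := by
  unfold tableZL; rw [map_offs_readZ, tableL_readN h]

/-! ### The point register as a table -/

section Points

variable {n ℓ : ℕ}

/-- **The flat content of the point register**: the `n` coordinate blocks of `ℓ` bits in order. [cite: Regev2009, Lemma 3.14 (proof)] -/
def pointsWord (Y : Fin n → Fin ℓ → Bool) : List Bool := (List.ofFn fun i => List.ofFn (Y i)).flatten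

/-- Length of the point register's content. [folklore] -/
theorem length_pointsWord (Y : Fin n → Fin ℓ → Bool) : (pointsWord Y).length = n * ℓ := by
  unfold pointsWord
  rw [List.length_flatten, List.map_ofFn, List.sum_ofFn]
  simp

/-- Prefix values are values of reversed prefix words (Horner). [cite: KnuthTAOCP2, §4.1] -/
private theorem hiVal_eq_bitsToNat_reverse_aux (y : Fin ℓ → Bool) :
    ∀ (j : ℕ) (hj : j ≤ ℓ), hiVal j y = bitsToNat (List.ofFn fun i : Fin j => y ⟨i, lt_of_lt_of_le i.2 hj⟩).reverse
  | 0, _ => by simp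
  | j + 1, hj => by
    have hj' : j < ℓ := hj
    have h := hiVal_succ ⟨j, hj'⟩ y
    rw [h, hiVal_eq_bitsToNat_reverse_aux y j hj'.le, List.ofFn_succ', List.concat_eq_append, List.reverse_append, List.reverse_singleton,
      List.singleton_append, bitsToNat_cons]
    simp only [Fin.val_castSucc, Fin.val_last]
    cases y ⟨j, hj'⟩ <;> simp; ring

/-- **`binVal y = bitsToNat (reverse [y₀, …, y_{ℓ−1}])`.** [cite: KnuthTAOCP2, §4.1] -/
theorem binVal_eq_bitsToNat_reverse (y : Fin ℓ → Bool) : binVal y = bitsToNat (List.ofFn y).reverse :=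
  hiVal_eq_bitsToNat_reverse_aux y ℓ le_rfl

/-- **The numeral of `binVal y` is the block `y` itself.** [cite: KnuthTAOCP2, §4.1] -/
theorem bitsMSBL_binVal (y : Fin ℓ → Bool) : bitsMSBL ℓ (binVal y) = List.ofFn y := by
  rw [binVal_eq_bitsToNat_reverse, bitsMSBL_bitsToNat_reverse (List.length_ofFn)]

/-- **The point register's content is the table of the block values.** [cite: Regev2009, Lemma 3.14 (proof)] -/
theorem pointsWord_eq_tableL (Y : Fin n → Fin ℓ → Bool) : pointsWord Y = tableL ℓ (List.ofFn fun i => binVal (Y i)) := by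
  unfold pointsWord tableL
  rw [List.map_ofFn]
  exact congrArg List.flatten (List.ofFn_inj.2 (funext fun i => (bitsMSBL_binVal (Y i)).symm))

/-- Reading the point register gives the block values. [folklore] -/
theorem readN_pointsWord (Y : Fin n → Fin ℓ → Bool) : readN ℓ n (pointsWord Y) = List.ofFn fun i => binVal (Y i) := by
  rw [pointsWord_eq_tableL]
  have h := readN_tableL (ℓ := ℓ) (s := List.ofFn fun i => binVal (Y i)) fun v hv => by
    obtain ⟨i, rfl⟩ := (List.mem_ofFn' _ _).1 hv
    exact binVal_lt _
  rwa [List.length_ofFn] at h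

/-- **Reading the point register as offset integers gives the grid vector `x̃ = (cellPt (Y i))ᵢ`.**
[cite: Regev2009, Lemma 3.14 (proof) with §2 p. 11] -/
theorem readZ_pointsWord (Y : Fin n → Fin ℓ → Bool) : readZ ℓ n (pointsWord Y) = List.ofFn fun i => cellPt ℓ (Y i) := by
  unfold readZ
  rw [readN_pointsWord, List.map_ofFn]
  rfl

/-- **Tabulating the grid vector gives the point register's content back.** [cite: Regev2009, Lemma 3.14 (proof: "uncompute the first register")] -/
theorem tableZL_cellPt (Y : Fin n → Fin ℓ → Bool) : tableZL ℓ (List.ofFn fun i => cellPt ℓ (Y i)) = pointsWord Y := by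
  rw [← readZ_pointsWord, tableZL_readZ (length_pointsWord Y)]

end Points

/-! ### Polynomial time on codes -/

section Codes

/-- `2^{ℓ−1}` from `1^ℓ` (drop one `1`, then the power). [folklore] -/
theorem codeFP_halfPow : CodeFP unE natE (fun ℓ => 2 ^ (ℓ - 1)) :=
  have hpred : CodeFP unE unE (fun n => n - 1) :=
    (strLength.comp (strDrop.comp ((const unE 1).pair strOfUn))).congr fun n => by simp
  (natPow.comp ((const _ (2 : ℕ)).pair hpred) :)

/-- **Numerals on codes**: `(1^ℓ, bin v) ↦ bitsMSBL ℓ v`. [cite: AroraBarak2009, §1.3] -/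
theorem codeFP_bitsMSBL : CodeFP (pairE unE natE) strE (fun p => bitsMSBL p.1 p.2) := by
  have hrev : CodeFP strE strE List.reverse := ⟨List.reverse, reverse_mem_FP, fun _ => rfl⟩
  have hrep : CodeFP unE strE (fun ℓ => List.replicate ℓ false) :=
    (bitsToStr.comp ((replicateOf bitE).comp ((const unE false).pair (CodeFP.id unE)))).congr fun _ => rfl
  have hl : CodeFP (pairE unE natE) unE (fun p => p.1) := fst _ _
  have hv : CodeFP (pairE unE natE) natE (fun p => p.2) := snd _ _
  have happ : CodeFP (pairE unE natE) strE (fun p => natE p.2 ++ List.replicate p.1 false) :=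
    (strAppend.comp ((strOfNat.comp hv).pair (hrep.comp hl)) :)
  have htake : CodeFP (pairE unE natE) strE (fun p => (natE p.2 ++ List.replicate p.1 false).take p.1) := (strTake.comp (hl.pair happ) :)
  exact (hrev.comp htake).congr fun p => by
    rw [bitsMSBL, ← EasyWitness.take_encodeNat_append]

/-- **Tables on codes.** [cite: AroraBarak2009, §1.3] -/
theorem codeFP_tableL : CodeFP (pairE unE (rawE natE)) strE (fun p => tableL p.1 p.2) :=
  (strFlatten.comp (map (g := fun q : ℕ × ℕ => bitsMSBL q.1 q.2) codeFP_bitsMSBL)).congr fun _ => rfl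

/-- The offset map on codes. [folklore] -/
theorem codeFP_offs : CodeFP (pairE unE intE) natE (fun p => offs p.1 p.2) := by
  have h2 : CodeFP (pairE unE intE) natE (fun p => 2 ^ (p.1 - 1)) := (codeFP_halfPow.comp (fst _ _) :)
  exact (intToNat.comp (intAdd.comp ((snd _ _).pair (intOfNat.comp h2)))).congr fun _ => rfl

/-- **Offset-binary tables on codes.** [cite: AroraBarak2009, §1.3] -/
theorem codeFP_tableZL : CodeFP (pairE unE ivecE) strE (fun p => tableZL p.1 p.2) :=
  (codeFP_tableL.comp ((fst _ _).pair (map codeFP_offs))).congr fun _ => rfl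

/-- **The reader on codes**: `(1^ℓ, 1ⁿ, bits) ↦ readN ℓ n bits`. [cite: AroraBarak2009, §1.3] -/
theorem codeFP_readN : CodeFP (pairE unE (pairE unE strE)) (rawE natE) (fun p => readN p.1 p.2.1 p.2.2) := by
  have hrev : CodeFP strE strE List.reverse := ⟨List.reverse, reverse_mem_FP, fun _ => rfl⟩
  have hch : CodeFP (pairE unE (pairE unE strE)) (rawE strE) (fun p => (List.range p.2.1).map fun i => (p.2.2.drop (i * p.1)).take p.1) :=
    (strChunks.comp ((snd _ _).fst'.pair ((fst _ _).pair (snd _ _).snd')) :)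
  exact ((map₀ (strVal.comp hrev)).comp hch).congr fun p => by
    simp only [readN, List.map_map]
    rfl

/-- **The offset reader on codes.** [cite: AroraBarak2009, §1.3] -/
theorem codeFP_readZ : CodeFP (pairE unE (pairE unE strE)) ivecE (fun p => readZ p.1 p.2.1 p.2.2) := by
  have hg : CodeFP (pairE unE natE) intE (fun q : ℕ × ℕ => (q.2 : ℤ) - 2 ^ (q.1 - 1)) :=
    (intSub.comp ((intOfNat.comp (snd _ _)).pair (intOfNat.comp (codeFP_halfPow.comp (fst _ _)))) :)
  exact ((map hg).comp ((fst _ _).pair codeFP_readN)).congr fun _ => rfl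

end Codes

end SamplerFormats

end Regev2009

end Literature.Computability.Cryptography

end
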